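import Summits.AtomisticToContinuum.HydrodynamicLimit.Theorems.MourreKoopmanChargesStressStrongMixingStressFramework
import HarnessLib

/-!
# `StressStrongMixing` · line `birth`, stub F3 `stub_spaceClusteringDensityOne`: reduction of the admissibility of the
# flow–shift span to its generators (static `L²` bounds + ONE-time-difference spatial clustering of generator pairs)

Support file for the crux item stmt-AtomisticToContinuum-9584 (`StressStrongMixing`, route `MourreKoopmanCharges` of
`AtomisticToContinuum/HydrodynamicLimit`), line `birth`.  Stub F3 asks that `hardSphereObs Φ = flowShiftSpan Φ localPolyObs`
be an admissible observable space (`IsLocalObservableSpace Φ μ _`: square integrability, spatially integrable truncated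
correlations `x ↦ Cov_μ(f, g ∘ τ_x)` for ALL `f, g` in the span — arbitrary finite words in flow maps and translations
applied to local polynomial observables —, non-negative structure factor).  This file reduces the two analytic clauses
to the GENERATORS, for any generating set `S`, any probability measure `μ` preserved by the flow maps and the translations,
with the a.e. group law and a.e. translation covariance of the flow (the data of a `FluctuationDynamics`):

* `memLp_of_mem_flowShiftSpan` — if every generator is in `L²(μ)` then so is every element of the flow–shift span
  (minimality of the span against the submodule of `L²` functions, stable under measure-preserving compositions);
* `exists_ae_eq_span_orbit_of_mem_flowShiftSpan` — every element of the span is `μ`-a.e. equal to a finite linear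
  combination of ORBIT observables `a ∘ Φ_t ∘ τ_y`, `a ∈ S` (words collapse a.e. by the group law and covariance);
* `cov_orbit_pair` — `Cov_μ(a ∘ Φ_t ∘ τ_y, (b ∘ Φ_{t'} ∘ τ_{y'}) ∘ τ_x) = Cov_μ(a, (b ∘ Φ_{t'-t}) ∘ τ_{y'+x-y})` (stationarity,
  translation invariance): two-point functions of orbit pairs are one-time-difference two-point functions of generators;
* `integrable_cov_of_mem_flowShiftSpan` — hence, if `x ↦ Cov_μ(a, (b ∘ Φ_t) ∘ τ_x)` is integrable on `ℝ³` for all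
  generators `a, b ∈ S` and every time `t` (TWO-TIME SPATIAL CLUSTERING OF GENERATOR PAIRS), then `x ↦ Cov_μ(f, g ∘ τ_x)`
  is integrable for all `f, g` in the flow–shift span;
* `isLocalObservableSpace_hardSphereObs_of_generators` — the registered helper: F3's admissibility of `hardSphereObs Φ`
  follows from (F3a) `L²` bounds for local polynomial observables, (F3b) two-time clustering of pairs of local polynomial
  observables, (F3c) non-negativity of the structure factor on the span (a Følner consequence of F3b, kept as a
  hypothesis), given stationarity, translation invariance, the a.e. group law and a.e. covariance.

References: B. Doyon, CMP 391 (2022), §4.1 Def. 4.3–4.4 and Remark 4.7 (clustering of the time-evolved local observables);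
H. Spohn, *Large Scale Dynamics of Interacting Particles* (1991), Part I §7.1 (7.6).
-/

noncomputable section

open MeasureTheory ProbabilityTheory Filter Topology
open scoped InnerProductSpace ENNReal

namespace Summit.AtomisticToContinuum.HydrodynamicLimit.Theorems.MourreKoopmanChargesStressStrongMixing

open Literature.MathematicalPhysics.KineticTheory Literature.Analysis.FluidPDE

variable {σ : ℝ}

/-- The spatial translations compose additively: `τ_{x+y} = τ_x ∘ τ_y` (as maps). [folklore] -/
theorem spatialShift_add (x y : V3) :
    (spatialShift (x + y) : MarkedConfig → MarkedConfig) = spatialShift x ∘ spatialShift y := by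
  rw [← ShiftAction.toFun_eq_coe]
  exact spatialShift.map_add x y

/-- `τ_0 = id`. [folklore] -/
theorem spatialShift_zero : (spatialShift (0 : V3) : MarkedConfig → MarkedConfig) = id := by
  rw [← ShiftAction.toFun_eq_coe]
  exact spatialShift.map_zero

/-! ### `L²` closure of the flow–shift span -/

/-- **`L²` closure**: if the flow maps and the translations preserve `μ` and every generator is in `L²(μ)`, then every
element of the flow–shift span is in `L²(μ)`. [folklore] -/
theorem memLp_of_mem_flowShiftSpan (Φ : InfiniteHardSphereFlow (Fin 3) σ) (μ : Measure MarkedConfig)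
    {S : Set (MarkedConfig → ℝ)} (hflow : ∀ t, MeasurePreserving (Φ.flow t) μ μ)
    (hshift : ∀ x : V3, MeasurePreserving (spatialShift x) μ μ) (hS : ∀ a ∈ S, MemLp a 2 μ)
    {f : MarkedConfig → ℝ} (hf : f ∈ flowShiftSpan Φ S) : MemLp f 2 μ := by
  let W : Submodule ℝ (MarkedConfig → ℝ) :=
    { carrier := {g | MemLp g 2 μ}
      zero_mem' := MemLp.zero
      add_mem' := fun hg hg' => hg.add hg'
      smul_mem' := fun c g hg => (hg : MemLp g 2 μ).const_smul c }
  have hle : flowShiftSpan Φ S ≤ W :=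
    flowShiftSpan_le (fun a ha => hS a ha)
      (fun t g hg => (hg : MemLp g 2 μ).comp_measurePreserving (hflow t))
      (fun x g hg => (hg : MemLp g 2 μ).comp_measurePreserving (hshift x))
  exact hle hf

/-! ### Orbit observables and the collapse of words -/

/-- **Two-point functions of orbit pairs are one-time-difference two-point functions of generators**: for `a, b ∈ L²(μ)`,
if `μ` is preserved by the flow maps and the translations, the flow has the a.e. group law and commutes a.e. with the
translations, then
`Cov_μ(a ∘ Φ_t ∘ τ_y, (b ∘ Φ_{t'} ∘ τ_{y'}) ∘ τ_x) = Cov_μ(a, (b ∘ Φ_{t'-t}) ∘ τ_{y'+x-y})`. [folklore] -/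
theorem cov_orbit_pair (Φ : InfiniteHardSphereFlow (Fin 3) σ) (μ : Measure MarkedConfig)
    (hflow : ∀ t, MeasurePreserving (Φ.flow t) μ μ) (hshift : ∀ x : V3, MeasurePreserving (spatialShift x) μ μ)
    (hadd : ∀ s t : ℝ, Φ.flow (s + t) =ᵐ[μ] Φ.flow s ∘ Φ.flow t)
    (hcomm : ∀ (t : ℝ) (x : V3), Φ.flow t ∘ spatialShift x =ᵐ[μ] spatialShift x ∘ Φ.flow t)
    {a b : MarkedConfig → ℝ} (ha : MemLp a 2 μ) (hb : MemLp b 2 μ) (t t' : ℝ) (y y' x : V3) :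
    cov[a ∘ Φ.flow t ∘ spatialShift y, (b ∘ Φ.flow t' ∘ spatialShift y') ∘ spatialShift x; μ] =
      cov[a, (b ∘ Φ.flow (t' - t)) ∘ spatialShift (y' + x - y); μ] := by
  set z : V3 := y' + x - y with hz
  -- Step 1: strip the common translation `τ_y`
  have h1 : (b ∘ Φ.flow t' ∘ spatialShift y') ∘ spatialShift x = (b ∘ Φ.flow t' ∘ spatialShift z) ∘ spatialShift y := by
    have e1 : (spatialShift y' : MarkedConfig → MarkedConfig) ∘ spatialShift x = spatialShift (y' + x) :=
      (spatialShift_add y' x).symm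
    have e2 : (spatialShift z : MarkedConfig → MarkedConfig) ∘ spatialShift y = spatialShift (y' + x) := by
      rw [← spatialShift_add, hz, sub_add_cancel]
    calc (b ∘ Φ.flow t' ∘ spatialShift y') ∘ spatialShift x = b ∘ Φ.flow t' ∘ (spatialShift y' ∘ spatialShift x) := rfl
      _ = b ∘ Φ.flow t' ∘ (spatialShift z ∘ spatialShift y) := by rw [e1, e2]
      _ = (b ∘ Φ.flow t' ∘ spatialShift z) ∘ spatialShift y := rfl
  have hbt'z : MemLp (b ∘ Φ.flow t' ∘ spatialShift z) 2 μ :=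
    (hb.comp_measurePreserving (hflow t')).comp_measurePreserving (hshift z)
  have hat : MemLp (a ∘ Φ.flow t) 2 μ := ha.comp_measurePreserving (hflow t)
  rw [h1, show a ∘ Φ.flow t ∘ spatialShift y = (a ∘ Φ.flow t) ∘ spatialShift y from rfl,
    covariance_comp_measurePreserving (hshift y) hat.aestronglyMeasurable hbt'z.aestronglyMeasurable]
  -- Step 2: `b ∘ Φ_{t'} ∘ τ_z =ᵐ (b ∘ Φ_{t'-t} ∘ τ_z) ∘ Φ_t`
  have h2 : b ∘ Φ.flow t' ∘ spatialShift z =ᵐ[μ] (b ∘ Φ.flow (t' - t) ∘ spatialShift z) ∘ Φ.flow t := by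
    have g1 : Φ.flow t' =ᵐ[μ] Φ.flow (t' - t) ∘ Φ.flow t := by
      have := hadd (t' - t) t
      rwa [sub_add_cancel] at this
    have g2 : Φ.flow t' ∘ spatialShift z =ᵐ[μ] (Φ.flow (t' - t) ∘ Φ.flow t) ∘ spatialShift z :=
      (hshift z).quasiMeasurePreserving.ae_eq_comp g1
    have g3 : (Φ.flow (t' - t) ∘ Φ.flow t) ∘ spatialShift z =ᵐ[μ] Φ.flow (t' - t) ∘ (spatialShift z ∘ Φ.flow t) :=
      (hcomm t z).fun_comp (Φ.flow (t' - t))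
    exact ((g2.trans g3).fun_comp b)
  have hbz : MemLp (b ∘ Φ.flow (t' - t) ∘ spatialShift z) 2 μ :=
    (hb.comp_measurePreserving (hflow (t' - t))).comp_measurePreserving (hshift z)
  rw [covariance_congr_ae EventuallyEq.rfl h2,
    covariance_comp_measurePreserving (hflow t) ha.aestronglyMeasurable hbz.aestronglyMeasurable]
  rfl

/-- **Collapse of words**: under the same hypotheses (plus `Φ_0 = id` a.e.), every element of the flow–shift span of `S`
is `μ`-a.e. equal to a finite linear combination of orbit observables `a ∘ Φ_t ∘ τ_y`, `a ∈ S`. [folklore] -/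
theorem exists_ae_eq_span_orbit_of_mem_flowShiftSpan (Φ : InfiniteHardSphereFlow (Fin 3) σ) (μ : Measure MarkedConfig)
    {S : Set (MarkedConfig → ℝ)} (hflow : ∀ t, MeasurePreserving (Φ.flow t) μ μ)
    (hshift : ∀ x : V3, MeasurePreserving (spatialShift x) μ μ) (hzero : Φ.flow 0 =ᵐ[μ] id)
    (hadd : ∀ s t : ℝ, Φ.flow (s + t) =ᵐ[μ] Φ.flow s ∘ Φ.flow t)
    (hcomm : ∀ (t : ℝ) (x : V3), Φ.flow t ∘ spatialShift x =ᵐ[μ] spatialShift x ∘ Φ.flow t)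
    {f : MarkedConfig → ℝ} (hf : f ∈ flowShiftSpan Φ S) :
    ∃ g ∈ Submodule.span ℝ {o : MarkedConfig → ℝ | ∃ a ∈ S, ∃ (t : ℝ) (y : V3), o = a ∘ Φ.flow t ∘ spatialShift y},
      f =ᵐ[μ] g := by
  set O : Set (MarkedConfig → ℝ) := {o | ∃ a ∈ S, ∃ (t : ℝ) (y : V3), o = a ∘ Φ.flow t ∘ spatialShift y} with hO
  -- the submodule of functions a.e. equal to an element of `span O`
  let W : Submodule ℝ (MarkedConfig → ℝ) :=
    { carrier := {f | ∃ g ∈ Submodule.span ℝ O, f =ᵐ[μ] g}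
      zero_mem' := ⟨0, Submodule.zero_mem _, EventuallyEq.rfl⟩
      add_mem' := by
        rintro f₁ f₂ ⟨g₁, hg₁, h₁⟩ ⟨g₂, hg₂, h₂⟩
        exact ⟨g₁ + g₂, Submodule.add_mem _ hg₁ hg₂, h₁.add h₂⟩
      smul_mem' := by
        rintro c f ⟨g, hg, h⟩
        exact ⟨c • g, Submodule.smul_mem _ c hg, h.const_smul c⟩ }
  -- orbit observables are stable (a.e.) under the flow and (exactly) under the translations
  have horb_flow : ∀ (s : ℝ), ∀ o ∈ O, ∃ o' ∈ O, o ∘ Φ.flow s =ᵐ[μ] o' := by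
    rintro s _ ⟨a, ha, t, y, rfl⟩
    refine ⟨a ∘ Φ.flow (t + s) ∘ spatialShift y, ⟨a, ha, t + s, y, rfl⟩, ?_⟩
    -- `a ∘ Φ_t ∘ τ_y ∘ Φ_s =ᵐ a ∘ Φ_t ∘ Φ_s ∘ τ_y =ᵐ a ∘ Φ_{t+s} ∘ τ_y`
    have g1 : (spatialShift y : MarkedConfig → MarkedConfig) ∘ Φ.flow s =ᵐ[μ] Φ.flow s ∘ spatialShift y :=
      (hcomm s y).symm
    have g2 : Φ.flow t ∘ (spatialShift y ∘ Φ.flow s) =ᵐ[μ] Φ.flow t ∘ (Φ.flow s ∘ spatialShift y) :=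
      g1.fun_comp (Φ.flow t)
    have g3 : (Φ.flow t ∘ Φ.flow s) ∘ spatialShift y =ᵐ[μ] Φ.flow (t + s) ∘ spatialShift y :=
      (hshift y).quasiMeasurePreserving.ae_eq_comp (hadd t s).symm
    exact ((g2.trans g3).fun_comp a)
  have horb_shift : ∀ (x : V3), ∀ o ∈ O, o ∘ spatialShift x ∈ O := by
    rintro x _ ⟨a, ha, t, y, rfl⟩
    refine ⟨a, ha, t, y + x, ?_⟩
    rw [spatialShift_add]
    rfl
  -- hence `span O` is stable a.e. under the flow and exactly under the translations
  have hspan_flow : ∀ (s : ℝ), ∀ g ∈ Submodule.span ℝ O, ∃ g' ∈ Submodule.span ℝ O, g ∘ Φ.flow s =ᵐ[μ] g' := by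
    intro s g hg
    induction hg using Submodule.span_induction with
    | mem o ho =>
      obtain ⟨o', ho', h⟩ := horb_flow s o ho
      exact ⟨o', Submodule.subset_span ho', h⟩
    | zero => exact ⟨0, Submodule.zero_mem _, EventuallyEq.rfl⟩
    | add g₁ g₂ _ _ ih₁ ih₂ =>
      obtain ⟨g₁', hg₁', h₁⟩ := ih₁
      obtain ⟨g₂', hg₂', h₂⟩ := ih₂
      exact ⟨g₁' + g₂', Submodule.add_mem _ hg₁' hg₂', h₁.add h₂⟩
    | smul c g _ ih =>
      obtain ⟨g', hg', h⟩ := ih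
      exact ⟨c • g', Submodule.smul_mem _ c hg', h.const_smul c⟩
  have hspan_shift : ∀ (x : V3), ∀ g ∈ Submodule.span ℝ O, g ∘ spatialShift x ∈ Submodule.span ℝ O := by
    intro x g hg
    induction hg using Submodule.span_induction with
    | mem o ho => exact Submodule.subset_span (horb_shift x o ho)
    | zero => exact Submodule.zero_mem _
    | add g₁ g₂ _ _ ih₁ ih₂ => exact Submodule.add_mem _ ih₁ ih₂
    | smul c g _ ih => exact Submodule.smul_mem _ c ih
  -- minimality of the flow–shift span against `W`
  have hle : flowShiftSpan Φ S ≤ W := by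
    refine flowShiftSpan_le ?_ ?_ ?_
    · intro a ha
      refine ⟨a ∘ Φ.flow 0 ∘ spatialShift 0, Submodule.subset_span ⟨a, ha, 0, 0, rfl⟩, ?_⟩
      rw [spatialShift_zero, Function.comp_id]
      have : (a : MarkedConfig → ℝ) = a ∘ id := rfl
      exact (hzero.fun_comp a).symm
    · rintro s f ⟨g, hg, h⟩
      obtain ⟨g', hg', h'⟩ := hspan_flow s g hg
      exact ⟨g', hg', ((hflow s).quasiMeasurePreserving.ae_eq_comp h).trans h'⟩
    · rintro x f ⟨g, hg, h⟩
      exact ⟨g ∘ spatialShift x, hspan_shift x g hg, (hshift x).quasiMeasurePreserving.ae_eq_comp h⟩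
  exact hle hf

/-! ### Integrable truncated correlations: from generator pairs to the whole span -/

/-- **Spatial clustering of the span from two-time clustering of generator pairs.** If `μ` is a probability measure
preserved by the flow maps and the translations, the flow has `Φ_0 = id` a.e., the a.e. group law and a.e. translation
covariance, every generator is in `L²(μ)`, and `x ↦ Cov_μ(a, (b ∘ Φ_t) ∘ τ_x)` is integrable on `ℝ³` for all generators
`a, b ∈ S` and every time `t`, then `x ↦ Cov_μ(f, g ∘ τ_x)` is integrable for all `f, g` in the flow–shift span of `S`.
[folklore] -/
theorem integrable_cov_of_mem_flowShiftSpan (Φ : InfiniteHardSphereFlow (Fin 3) σ) (μ : Measure MarkedConfig)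
    [IsProbabilityMeasure μ] {S : Set (MarkedConfig → ℝ)} (hflow : ∀ t, MeasurePreserving (Φ.flow t) μ μ)
    (hshift : ∀ x : V3, MeasurePreserving (spatialShift x) μ μ) (hzero : Φ.flow 0 =ᵐ[μ] id)
    (hadd : ∀ s t : ℝ, Φ.flow (s + t) =ᵐ[μ] Φ.flow s ∘ Φ.flow t)
    (hcomm : ∀ (t : ℝ) (x : V3), Φ.flow t ∘ spatialShift x =ᵐ[μ] spatialShift x ∘ Φ.flow t)
    (hS : ∀ a ∈ S, MemLp a 2 μ)
    (hclust : ∀ a ∈ S, ∀ b ∈ S, ∀ t : ℝ, Integrable (fun x : V3 => cov[a, (b ∘ Φ.flow t) ∘ spatialShift x; μ]) volume)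
    {f g : MarkedConfig → ℝ} (hf : f ∈ flowShiftSpan Φ S) (hg : g ∈ flowShiftSpan Φ S) :
    Integrable (fun x : V3 => cov[f, g ∘ spatialShift x; μ]) volume := by
  set O : Set (MarkedConfig → ℝ) := {o | ∃ a ∈ S, ∃ (t : ℝ) (y : V3), o = a ∘ Φ.flow t ∘ spatialShift y} with hO
  -- `L²` membership of orbit observables and of their span
  have hOmem : ∀ o ∈ O, MemLp o 2 μ := by
    rintro _ ⟨a, ha, t, y, rfl⟩
    exact ((hS a ha).comp_measurePreserving (hflow t)).comp_measurePreserving (hshift y)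
  have hspan_mem : ∀ g ∈ Submodule.span ℝ O, MemLp g 2 μ := by
    intro g hg
    induction hg using Submodule.span_induction with
    | mem o ho => exact hOmem o ho
    | zero => exact MemLp.zero
    | add g₁ g₂ _ _ ih₁ ih₂ => exact ih₁.add ih₂
    | smul c g _ ih => exact ih.const_smul c
  -- orbit pairs: integrable by `cov_orbit_pair` and translation invariance of Lebesgue measure
  have hOO : ∀ o₁ ∈ O, ∀ o₂ ∈ O, Integrable (fun x : V3 => cov[o₁, o₂ ∘ spatialShift x; μ]) volume := by
    rintro _ ⟨a, ha, t, y, rfl⟩ _ ⟨b, hb, t', y', rfl⟩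
    have key : (fun x : V3 => cov[a ∘ Φ.flow t ∘ spatialShift y, (b ∘ Φ.flow t' ∘ spatialShift y') ∘ spatialShift x; μ]) =
        fun x : V3 => (fun w : V3 => cov[a, (b ∘ Φ.flow (t' - t)) ∘ spatialShift w; μ]) (x + (y' - y)) := by
      funext x
      rw [cov_orbit_pair Φ μ hflow hshift hadd hcomm (hS a ha) (hS b hb) t t' y y' x]
      congr 2
      abel_nf
    rw [key]
    exact (hclust a ha b hb (t' - t)).comp_add_right (y' - y)
  -- span pairs: bilinearity of the covariance (all functions are in `L²`)
  have hspanO : ∀ o ∈ O, ∀ g' ∈ Submodule.span ℝ O, Integrable (fun x : V3 => cov[o, g' ∘ spatialShift x; μ]) volume := by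
    intro o ho g' hg'
    induction hg' using Submodule.span_induction with
    | mem o₂ ho₂ => exact hOO o ho o₂ ho₂
    | zero => simp
    | add g₁ g₂ hg₁ hg₂ ih₁ ih₂ =>
      have e : (fun x : V3 => cov[o, (g₁ + g₂) ∘ spatialShift x; μ]) =
          fun x => cov[o, g₁ ∘ spatialShift x; μ] + cov[o, g₂ ∘ spatialShift x; μ] := by
        funext x
        exact covariance_add_right (hOmem o ho)
          ((hspan_mem g₁ hg₁).comp_measurePreserving (hshift x)) ((hspan_mem g₂ hg₂).comp_measurePreserving (hshift x))
      rw [e]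
      exact ih₁.add ih₂
    | smul c g hg ih =>
      have e : (fun x : V3 => cov[o, (c • g) ∘ spatialShift x; μ]) = fun x => c * cov[o, g ∘ spatialShift x; μ] := by
        funext x
        exact covariance_smul_right c
      rw [e]
      exact ih.const_mul c
  have hspanspan : ∀ f' ∈ Submodule.span ℝ O, ∀ g' ∈ Submodule.span ℝ O,
      Integrable (fun x : V3 => cov[f', g' ∘ spatialShift x; μ]) volume := by
    intro f' hf' g' hg'
    induction hf' using Submodule.span_induction with
    | mem o ho => exact hspanO o ho g' hg'
    | zero => simp
    | add f₁ f₂ hf₁ hf₂ ih₁ ih₂ =>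
      have e : (fun x : V3 => cov[f₁ + f₂, g' ∘ spatialShift x; μ]) =
          fun x => cov[f₁, g' ∘ spatialShift x; μ] + cov[f₂, g' ∘ spatialShift x; μ] := by
        funext x
        exact covariance_add_left (hspan_mem f₁ hf₁) (hspan_mem f₂ hf₂)
          ((hspan_mem g' hg').comp_measurePreserving (hshift x))
      rw [e]
      exact ih₁.add ih₂
    | smul c f hf'' ih =>
      have e : (fun x : V3 => cov[c • f, g' ∘ spatialShift x; μ]) = fun x => c * cov[f, g' ∘ spatialShift x; μ] := by
        funext x
        exact covariance_smul_left c
      rw [e]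
      exact ih.const_mul c
  -- the span elements `f, g` are a.e. equal to elements of `span O`
  obtain ⟨f', hf', hff'⟩ := exists_ae_eq_span_orbit_of_mem_flowShiftSpan Φ μ hflow hshift hzero hadd hcomm hf
  obtain ⟨g', hg', hgg'⟩ := exists_ae_eq_span_orbit_of_mem_flowShiftSpan Φ μ hflow hshift hzero hadd hcomm hg
  have e : (fun x : V3 => cov[f, g ∘ spatialShift x; μ]) = fun x => cov[f', g' ∘ spatialShift x; μ] := by
    funext x
    exact covariance_congr_ae hff' ((hshift x).quasiMeasurePreserving.ae_eq_comp hgg')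
  rw [e]
  exact hspanspan f' hf' g' hg'

/-! ### The registered helper: F3 from its generator-level clauses -/

/-- **F3 from its generator-level clauses** (helper for the registered stub `stub_spaceClusteringDensityOne`): the
observable space `hardSphereObs Φ = flowShiftSpan Φ localPolyObs` is admissible for `μ` (`IsLocalObservableSpace Φ μ _`)
as soon as (dyn) `μ` is a probability measure preserved by every flow map and every translation, with `Φ_0 = id` a.e.,
the a.e. group law and a.e. translation covariance of the flow; (F3a, static) every local polynomial observable is in
`L²(μ)`; (F3b, the OPEN core) for all local polynomial `a, b` and every time `t`, `x ↦ Cov_μ(a, (b ∘ Φ_t) ∘ τ_x)` is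
integrable on `ℝ³`; (F3c) the zero-wavenumber structure factor is non-negative on the span. [folklore] -/
theorem isLocalObservableSpace_hardSphereObs_of_generators :
    ∀ {σ : ℝ} (Φ : InfiniteHardSphereFlow (Fin 3) σ) (μ : Measure MarkedConfig), IsProbabilityMeasure μ →
      (∀ t : ℝ, MeasurePreserving (Φ.flow t) μ μ) → (∀ x : V3, MeasurePreserving (spatialShift x) μ μ) →
      Φ.flow 0 =ᵐ[μ] id → (∀ s t : ℝ, Φ.flow (s + t) =ᵐ[μ] Φ.flow s ∘ Φ.flow t) →
      (∀ (t : ℝ) (x : V3), Φ.flow t ∘ spatialShift x =ᵐ[μ] spatialShift x ∘ Φ.flow t) →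
      (∀ a : MarkedConfig → ℝ, IsLocalPolyObs a → MemLp a 2 μ) →
      (∀ a b : MarkedConfig → ℝ, IsLocalPolyObs a → IsLocalPolyObs b → ∀ t : ℝ,
        Integrable (fun x : V3 => cov[a, (b ∘ Φ.flow t) ∘ spatialShift x; μ]) volume) →
      (∀ a ∈ hardSphereObs Φ, 0 ≤ ∫ x : V3, cov[a, a ∘ spatialShift x; μ]) →
      IsLocalObservableSpace Φ μ (hardSphereObs Φ) := by
  intro σ Φ μ hμ hflow hshift hzero hadd hcomm h2 hclust hpos
  refine isLocalObservableSpace_hardSphereObs_iff.2 ⟨?_, ?_, hpos⟩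
  · intro f hf
    exact memLp_of_mem_flowShiftSpan Φ μ hflow hshift (fun a ha => h2 a ha) hf
  · intro f hf g hg
    exact integrable_cov_of_mem_flowShiftSpan Φ μ hflow hshift hzero hadd hcomm (fun a ha => h2 a ha)
      (fun a ha b hb t => hclust a b ha hb t) hf hg

end Summit.AtomisticToContinuum.HydrodynamicLimit.Theorems.MourreKoopmanChargesStressStrongMixing

end
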